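import Mathlib
import HarnessLib
import Summits.Ventures.LatticeQCDFlow.Scaling.AutoregressiveBlockFaithful
import Summits.Ventures.LatticeQCDFlow.Scaling.KernelCondTailStrictMono

/-!
# LatticeQCDFlow / Scaling — STRICTLY monotone context: the exact conditional law of the current site
# is strictly stochastically increasing in every site chained to it through the block

HONEST FRAMING: exact (Metropolis-corrected) sampling algorithms for lattice gauge theory;
figures of merit are autocorrelation/cost numbers at stated couplings and volumes; no
continuum-physics claim.

Venture `LatticeQCDFlow` (cell pub-lqcd), topic `Scaling`, FANOUT row 30 (lean-1, GEN-17) — OUR WORK, the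
strict form of `Scaling/AutoregressiveMonotoneContext` (TP₂ ⇒ the conditional tail probability of `φ_a`
is non-decreasing in every context variable) obtained from the strict squares of
`Scaling/AutoregressiveBlockFaithful`:

* (strict Karlin–Rubin `tp2_condTail_strictMono` is `Scaling/KernelCondTailStrictMono`.)
* §1 **`pairBondWeight_condTail_strictMono_of_chain`** — for a ferromagnetic pair interaction on any
  graph (positive bounded measurable factors, TP₂ bonds) and an integrated strictly-linked chain from
  the current site `a` to a retained `j` (reference measure not a point mass), for every configuration
  `z`, threshold `c` splitting `μ` and `t < t'`:
  `P(φ_a > c | z[j↦t]) < P(φ_a > c | z[j↦t'])`, `P(φ_a > c | ψ) = ∫_{u>c} A_s w(ψ[a↦u]) / ∫ A_s w(ψ[a↦u])`;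
  **`pairBondWeight_condTail_strictMono_of_mem_outer`** — the frontier form: generating from the top,
  strictly increasing in EVERY `v ∈ outer G (lowerComp G a) = adj⁺_{elim G}(a)`.

READING (value-free): the exact Knothe–Rosenblatt transport of a strictly TP₂ ferromagnet is STRICTLY
monotone in each fill-neighbour coordinate — every such coordinate moves every conditional quantile.
NOT CLAIMED: rates; gauge theories; any number of ours.  Elementary over the parents; nothing is cited
as a fact; no `def`; no `sorry`.
-/

noncomputable section

namespace Summit.Ventures.LatticeQCDFlow.Theory2.Autoregressive

open MeasureTheory Function Set
open Summit.Ventures.LatticeQCDFlow.Exactness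

variable {κ : Type*} {X : Type*} [LinearOrder X] [MeasurableSpace X]

/-! ## §1 The strictly monotone context -/

section StrictMono

/-- **THE EXACT CONDITIONAL LAW OF THE CURRENT SITE IS STRICTLY STOCHASTICALLY INCREASING IN EVERY
SITE CHAINED TO IT THROUGH THE BLOCK**: under the hypotheses of
`pairBondWeight_coordAvg_pureSq_of_chain` (ferromagnetic pair interaction on any graph, positive bounded
measurable factors, TP₂ bonds, an integrated strictly-linked chain from `a` to `j`, reference measure not
a point mass) and for a threshold `c` splitting `μ` (`μ{u > c} > 0`, `μ{u ≤ c} > 0`, tail measurable):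
`t < t'` ⇒ `P(φ_a > c | z[j ↦ t]) < P(φ_a > c | z[j ↦ t'])` with
`P(φ_a > c | ψ) = ∫_{u>c} N(ψ[a↦u]) dμ(u) / ∫ N(ψ[a↦u]) dμ(u)`, `N = A_s w` — the strict form of
`AutoregressiveMonotoneContext.arConditional_tail_mono`. [ours] -/
theorem pairBondWeight_condTail_strictMono_of_chain {η : Type*} [Fintype κ] [DecidableEq κ]
    (μ : Measure X) [IsProbabilityMeasure μ]
    (hμ : 0 < (μ.prod μ) {p : X × X | p.1 < p.2}) (E : Finset η) (src tgt : η → κ)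
    (b : η → X → X → ℝ) (g : κ → X → ℝ) (hgm : ∀ i, Measurable (g i))
    (hbm : ∀ e, Measurable (uncurry (b e))) (hg0 : ∀ i u, 0 < g i u) (hb0 : ∀ e u v, 0 < b e u v)
    (hgC : ∀ i, ∃ C, ∀ u, g i u ≤ C) (hbC : ∀ e, ∃ C, ∀ u v, b e u v ≤ C)
    (hb : ∀ e u u' v v', u ≤ u' → v ≤ v' → b e u' v * b e u v' ≤ b e u v * b e u' v')
    (s : Finset κ) {a j : κ} (haj : a ≠ j) (ha : a ∉ s) (hj : j ∉ s) (P : List κ)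
    (hP : ∀ c ∈ P, c ∈ s) (hnd : P.Nodup)
    (hchain : List.IsChain (fun i k => i ≠ k ∧ ∃ e ∈ E,
        ((src e = i ∧ tgt e = k) ∨ (src e = k ∧ tgt e = i)) ∧
        ∀ u u' v v', u < u' → v < v' → b e u' v * b e u v' < b e u v * b e u' v') (a :: (P ++ [j])))
    (z : κ → X) {c : X} (hc : MeasurableSet {u | c < u}) (hA : 0 < μ {u | c < u})
    (hAc : 0 < μ {u | c < u}ᶜ) {t t' : X} (htt : t < t') :
    let w : (κ → X) → ℝ := fun x => (∏ i, g i (x i)) * ∏ e ∈ E, b e (x (src e)) (x (tgt e))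
    (∫ u in {u | c < u}, coordAvg μ s w (update (update z a u) j t) ∂μ) /
        (∫ u, coordAvg μ s w (update (update z a u) j t) ∂μ) <
      (∫ u in {u | c < u}, coordAvg μ s w (update (update z a u) j t') ∂μ) /
        (∫ u, coordAvg μ s w (update (update z a u) j t') ∂μ) := by
  intro w
  -- positivity, measurability, boundedness of `w` and of `N = A_s w`
  have hwpos : ∀ x, 0 < w x := fun x =>
    mul_pos (Finset.prod_pos fun i _ => hg0 i _) (Finset.prod_pos fun e _ => hb0 e _ _)
  have hwm : Measurable w :=
    (Finset.measurable_prod _ fun i _ => (hgm i).comp (measurable_pi_apply i)).mul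
      (Finset.measurable_prod _ fun e _ =>
        show Measurable (uncurry (b e) ∘ fun x : κ → X => (x (src e), x (tgt e))) from
          (hbm e).comp ((measurable_pi_apply _).prodMk (measurable_pi_apply _)))
  choose Cg hCg using hgC
  choose Cb hCb using hbC
  set C : ℝ := (∏ i, Cg i) * ∏ e ∈ E, Cb e with hCdef
  have hwC : ∀ x, w x ≤ C := fun x =>
    mul_le_mul (Finset.prod_le_prod (fun i _ => (hg0 i _).le) fun i _ => hCg i _)
      (Finset.prod_le_prod (fun e _ => (hb0 e _ _).le) fun e _ => hCb e _ _)
      (Finset.prod_nonneg fun e _ => (hb0 e _ _).le)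
      (Finset.prod_nonneg fun i _ => (hg0 i (x i)).le.trans (hCg i _))
  have hNm : Measurable (coordAvg μ s w) := by
    have hm : Measurable fun p : (κ → X) × (κ → X) => w (s.piecewise p.2 p.1) :=
      hwm.comp (measurable_piecewise_prod s)
    exact (hm.stronglyMeasurable.integral_prod_right' (ν := Measure.pi fun _ : κ => μ)).measurable
  have hNpos : ∀ x, 0 < coordAvg μ s w x :=
    coordAvg_pos μ s hwm hwpos ⟨C, fun x => by rw [abs_of_pos (hwpos x)]; exact hwC x⟩
  have hNC : ∀ x, coordAvg μ s w x ≤ C := fun x => by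
    unfold coordAvg
    calc (∫ ω', w (s.piecewise ω' x) ∂Measure.pi fun _ : κ => μ)
        ≤ ∫ _, C ∂Measure.pi fun _ : κ => μ :=
          integral_mono_of_nonneg (ae_of_all _ fun _ => (hwpos _).le) (integrable_const C)
            (ae_of_all _ fun ω' => hwC _)
      _ = C := by simp
  have hupd : ∀ r : X, Measurable fun u : X => update (update z a u) j r := fun r =>
    (measurable_update'.comp (measurable_id.prodMk measurable_const)).comp (measurable_update z)
  have hsec : ∀ r, Integrable (fun u => coordAvg μ s w (update (update z a u) j r)) μ := fun r =>
    Integrable.mono' (integrable_const C) ((hNm.comp (hupd r)).aestronglyMeasurable)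
      (ae_of_all _ fun u => by rw [Real.norm_eq_abs, abs_of_pos (hNpos _)]; exact hNC _)
  have hposI : ∀ r, 0 < ∫ u, coordAvg μ s w (update (update z a u) j r) ∂μ := fun r => by
    rw [integral_pos_iff_support_of_nonneg (fun u => (hNpos _).le) (hsec r)]
    have : Function.support (fun u => coordAvg μ s w (update (update z a u) j r)) = Set.univ :=
      Set.eq_univ_of_forall fun u => (hNpos _).ne'
    rw [this, measure_univ]; exact one_pos
  -- TP₂ (from MTP₂ of `A_s w`) and strict TP₂ (the chain) of the two-point section
  have hmtp := mtp2_coordAvg_pairBondWeight μ E src tgt b g hgm hbm (fun i u => (hg0 i u).le)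
    (fun e u v => (hb0 e u v).le) (fun i => ⟨Cg i, hCg i⟩) (fun e => ⟨Cb e, hCb e⟩) hb s
  have hK : ∀ u u' r r', u ≤ u' → r ≤ r' →
      coordAvg μ s w (update (update z a u) j r') * coordAvg μ s w (update (update z a u') j r) ≤
        coordAvg μ s w (update (update z a u) j r) * coordAvg μ s w (update (update z a u') j r') := by
    intro u u' r r' hu hr
    have h := hmtp (update (update z a u) j r') (update (update z a u') j r)
    rw [upd2_sup_upd2 z haj hu hr, upd2_inf_upd2 z haj hu hr] at h
    linarith [h, mul_comm (coordAvg μ s w (update (update z a u') j r'))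
      (coordAvg μ s w (update (update z a u) j r))]
  have hKs : ∀ u u' r r', u < u' → r < r' →
      coordAvg μ s w (update (update z a u) j r') * coordAvg μ s w (update (update z a u') j r) <
        coordAvg μ s w (update (update z a u) j r) * coordAvg μ s w (update (update z a u') j r') := by
    intro u u' r r' hu hr
    have h := pairBondWeight_coordAvg_pureSq_of_chain μ hμ E src tgt b g hgm hbm hg0 hb0
      (fun i => ⟨Cg i, hCg i⟩) (fun e => ⟨Cb e, hCb e⟩) hb s haj ha hj P hP hnd hchain z u u' r r' hu hr
    linarith [h, mul_comm (coordAvg μ s w (update (update z a u') j r'))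
      (coordAvg μ s w (update (update z a u) j r))]
  exact tp2_condTail_strictMono μ (fun u r => coordAvg μ s w (update (update z a u) j r)) hK hKs hsec
    hposI hc hA hAc htt

/-- **… IN EVERY FILL-NEIGHBOUR** (frontier form): on a graph `G` whose every edge carries a strictly
TP₂ bond, generating from the top (`s = {u | u < a}`), for every `v ∈ outer G (lowerComp G a)`
(`= adj⁺_{elim G}(a)`), every configuration `z`, threshold `c` splitting `μ` and `t < t'`:
`P(φ_a > c | z[v ↦ t]) < P(φ_a > c | z[v ↦ t'])`. [ours] -/
theorem pairBondWeight_condTail_strictMono_of_mem_outer {η V : Type*} [Fintype V] [LinearOrder V]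
    [DecidableEq V] (μ : Measure X) [IsProbabilityMeasure μ]
    (hμ : 0 < (μ.prod μ) {p : X × X | p.1 < p.2}) (G : SimpleGraph V) (E : Finset η)
    (src tgt : η → V) (b : η → X → X → ℝ) (g : V → X → ℝ) (hgm : ∀ i, Measurable (g i))
    (hbm : ∀ e, Measurable (uncurry (b e))) (hg0 : ∀ i u, 0 < g i u) (hb0 : ∀ e u v, 0 < b e u v)
    (hgC : ∀ i, ∃ C, ∀ u, g i u ≤ C) (hbC : ∀ e, ∃ C, ∀ u v, b e u v ≤ C)
    (hb : ∀ e u u' v v', u ≤ u' → v ≤ v' → b e u' v * b e u v' ≤ b e u v * b e u' v')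
    (hE : ∀ i k, G.Adj i k → ∃ e ∈ E, ((src e = i ∧ tgt e = k) ∨ (src e = k ∧ tgt e = i)) ∧
        ∀ u u' v v', u < u' → v < v' → b e u' v * b e u v' < b e u v * b e u' v')
    (a : V) {v : V} (hv : v ∈ outer G (lowerComp G a)) (z : V → X) {c : X}
    (hc : MeasurableSet {u | c < u}) (hA : 0 < μ {u | c < u}) (hAc : 0 < μ {u | c < u}ᶜ)
    {t t' : X} (htt : t < t') :
    let w : (V → X) → ℝ := fun x => (∏ i, g i (x i)) * ∏ e ∈ E, b e (x (src e)) (x (tgt e))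
    let s : Finset V := Finset.univ.filter (· < a)
    (∫ u in {u | c < u}, coordAvg μ s w (update (update z a u) v t) ∂μ) /
        (∫ u, coordAvg μ s w (update (update z a u) v t) ∂μ) <
      (∫ u in {u | c < u}, coordAvg μ s w (update (update z a u) v t') ∂μ) /
        (∫ u, coordAvg μ s w (update (update z a u) v t') ∂μ) := by
  intro w s
  obtain ⟨P, hPs, hPnd, hchainG, hav⟩ := exists_chain_of_mem_outer G a hv
  exact pairBondWeight_condTail_strictMono_of_chain μ hμ E src tgt b g hgm hbm hg0 hb0 hgC hbC hb s
    (ne_of_lt hav) (by simp [s]) (by simp [s, not_lt.2 hav.le]) P hPs hPnd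
    (hchainG.imp fun i k hik => ⟨hik.ne, hE i k hik⟩) z hc hA hAc htt

end StrictMono

end Summit.Ventures.LatticeQCDFlow.Theory2.Autoregressive

end
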